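import Literature.Geometry.Lorentzian.KerrDataSchwarzschildExtrinsic
import Literature.Geometry.Lorentzian.SchwarzschildKerrSchildComponents
import Literature.Geometry.Lorentzian.KerrHyperboloidalLeaves
import Literature.Geometry.Lorentzian.ChartSecondFundamentalForm
import Summits.FinalStateConjecture.FinalStateConjecture.Theorems.SwallowTheDatumKerrShieldedDataExistBridgeRadial
import HarnessLib

/-!
# `KerrShieldedDataExist`, line `plug-the-second-sheet` — the bridge annulus, III: second fundamental forms
# of radial immersions at the two rims

Support file (everything proved) for stub `stub_bridgeAnnulus` of crux `stmt-FinalStateConjecture-10055`.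

* `secondFundamentalForm_eq_half_of_repr` — for a map between chart domains with representatives `Φ, N`
  and the normality relation `G_{Φ z}(N z, DΦ(z) w) = 0` near `y`:
  `K_ν(v, w) = ½((∂_N G)(Φ_w, Φ_v) − (∂_{Φ_v} G)(N, Φ_w) − (∂_{Φ_w} G)(Φ_v, N)) − G(N, D²Φ(v, w))`
  (`OpensChart.secondFundamentalForm_eq_of_repr` + the first-kind Christoffel symbols + the derivative of the
  normality relation; O'Neill 1983, Ch. 3, Prop. 3.13 and Ch. 4, Lemma 4.4);
* `secondFundamentalForm_eq_zero_of_static` — INNER RIM: a radial immersion whose unit normal is a multiple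
  of the static Killing field `∂_{t*}` near a point (the Boyer–Lindquist slices `{t = const}`) is totally
  geodesic there (time-reflection symmetry; the Koszul form of `∂_{t*}` vanishes on tangent vectors);
* `secondFundamentalForm_eq_kRep` — OUTER RIM: the graph `t* = 4M log(1 − r/2M)` inside the horizon (the
  Kerr–Schild slice `{t* = 0}` of the OTHER ingoing chart of the Kruskal plane, O'Neill 1983, Ch. 13), with
  its future unit normal, has `K = Kerr.kRep M` (Cook 2000, (57)), by direct evaluation of the half formula
  with the closed-form derivatives `Kerr.fderiv_bilin_zero_apply`;
* `bilin_tangent_tangent_eq_hRep`, `bilin_tangent_tangent_eq_iso` — the induced metrics at the two rims: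
  `hRep M` (Cook 2000, (55)) and `(1 + M/2s)⁴ δ` (isotropic Schwarzschild, Wald 1984, §6.4).
-/

-- the doubled `FinalStateConjecture` path component is the summit/problem naming scheme, not a mistake
set_option linter.dupNamespace false

noncomputable section

open Real Set Filter
open scoped Manifold ContDiff Topology InnerProductSpace
open Literature.Geometry.Lorentzian

namespace Summit.FinalStateConjecture.FinalStateConjecture.Theorems.SwallowTheDatum

namespace Bridge

/-! ### The second fundamental form through first derivatives of the ambient metric -/

section Half

variable {E : Type*} [NormedAddCommGroup E] [NormedSpace ℝ E] [FiniteDimensional ℝ E]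
  {E' : Type*} [NormedAddCommGroup E'] [NormedSpace ℝ E'] [FiniteDimensional ℝ E']
  {V : TopologicalSpace.Opens E} {U : TopologicalSpace.Opens E'}
  {g : PseudoRiemannianMetric 𝓘(ℝ, E) ∞ E (TangentSpace 𝓘(ℝ, E) : V → Type _)}
  {G : E → E →L[ℝ] E →L[ℝ] ℝ}

/-- **The second fundamental form of a map between chart domains through the first derivatives of
the ambient metric components.** For `f : U → V` with representative `Φ` (twice differentiable at `y`
along the constant field `w`: `D(y ↦ DΦ(y) w) = Φ₂`), a field `ν` with representative `N`
differentiable at `y`, and the normality relation `G_{Φ z}(N z, DΦ(z) w) = 0` for `z` near `y`,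
`K_ν(v, w) = ½((∂_N G)(Φ_w, Φ_v) − (∂_{Φ_v} G)(N, Φ_w) − (∂_{Φ_w} G)(Φ_v, N)) − G(N, Φ₂ v)`
(`Φ_v = DΦ(y) v`): `K = G(DN v + Γ(N)(Φ_v), Φ_w)` (`secondFundamentalForm_eq_of_repr`), the
Christoffel symbols of the first kind `G(Γ(N)(Φ_v), Φ_w) = ½ K(N, Φ_v, Φ_w)` (`val_christoffel_const`,
O'Neill 1983, Ch. 3, Prop. 3.13) and `G(DN v, Φ_w) = −(∂_{Φ_v} G)(N, Φ_w) − G(N, Φ₂ v)` (differentiating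
the normality relation, O'Neill 1983, Ch. 4, proof of Lemma 4.4). [cite: ONeill1983, Ch. 4, Lemma 4.4] -/
theorem secondFundamentalForm_eq_half_of_repr [g.HasLeviCivita] (hG : ∀ x : V, g.val x = G x)
    {f : U → V} {Φ : E' → E} (hf : ∀ y : U, (f y : E) = Φ y) {ν : NormalField 𝓘(ℝ, E) f}
    {N : E' → E} (hν : ∀ y : U, ν y = N y) {y : U} (hΦ : DifferentiableAt ℝ Φ y)
    (hN : DifferentiableAt ℝ N y) (hGd : DifferentiableAt ℝ G (Φ y)) (v w : E')
    {Φ₂ : E' →L[ℝ] E} (hΦ₂ : HasFDerivAt (fun z : E' ↦ fderiv ℝ Φ z w) Φ₂ y)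
    (hnormal : ∀ᶠ z in 𝓝 (y : E'), G (Φ z) (N z) (fderiv ℝ Φ z w) = 0) :
    g.secondFundamentalForm 𝓘(ℝ, E') f ν y v w =
      2⁻¹ * (fderiv ℝ G (Φ y) (N y) (fderiv ℝ Φ y w) (fderiv ℝ Φ y v)
          - fderiv ℝ G (Φ y) (fderiv ℝ Φ y v) (N y) (fderiv ℝ Φ y w)
          - fderiv ℝ G (Φ y) (fderiv ℝ Φ y w) (fderiv ℝ Φ y v) (N y))
        - G (Φ y) (N y) (Φ₂ v) := by
  have hGd' : DifferentiableAt ℝ G (f y) := by rw [hf y]; exact hGd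
  have hval : ∀ a b : E, g.val (f y) a b = G (Φ y) a b := fun a b ↦ by rw [hG, hf]; rfl
  rw [OpensChart.secondFundamentalForm_eq_of_repr hG hf hν hΦ hN hGd' v w, hval, map_add, add_apply]
  have hΓ := OpensChart.val_christoffel_const (g := g) (G := G) (f y) (N y) (fderiv ℝ Φ y v)
    (fderiv ℝ Φ y w)
  rw [hval] at hΓ
  rw [hΓ, OpensChart.koszulForm_apply, hf y]
  -- the derivative of the normality relation
  have h0 : HasFDerivAt (fun z : E' ↦ G (Φ z) (N z) (fderiv ℝ Φ z w)) (0 : E' →L[ℝ] ℝ) y :=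
    (hasFDerivAt_const (0 : ℝ) (y : E')).congr_of_eventuallyEq hnormal
  have hB := HasFDerivAt.comp (G := E →L[ℝ] E →L[ℝ] ℝ) (y : E') hGd.hasFDerivAt hΦ.hasFDerivAt
  have h1 := (hB.clm_apply hN.hasFDerivAt).clm_apply hΦ₂
  have key := DFunLike.congr_fun (h0.unique h1) v
  simp only [zero_apply, add_apply, ContinuousLinearMap.comp_apply,
    ContinuousLinearMap.flip_apply, Function.comp_apply] at key
  -- `key : 0 = G N (Φ₂ v) + (G (DN v) + DG(Φ_v) N) (Φ_w)`
  have key' : G (Φ y) (fderiv ℝ N y v) (fderiv ℝ Φ y w) =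
      -(fderiv ℝ G (Φ y) (fderiv ℝ Φ y v) (N y) (fderiv ℝ Φ y w)) - G (Φ y) (N y) (Φ₂ v) := by
    linarith
  rw [key']
  ring

end Half


/-! ### Static slices: the second fundamental form vanishes -/

section Static

variable {M r₀ : ℝ} [Kerr.Facts] {U : TopologicalSpace.Opens E3} {f : U → Kerr.region 0 r₀} {Φ N : E3 → E4}
  {ν : NormalField 𝓘(ℝ, E4) f}

/-- **A radial immersion whose unit normal is a multiple of the static Killing field `∂_{t*}` is
totally geodesic.** If near `y` the representative of the normal is `N = λ ∂_{t*}` (this happens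
exactly on the static slices `t* = 2M log|r/2M − 1| + const`, the Boyer–Lindquist slices `{t = const}`:
the normality of `∂_{t*}` to `DΦ w` is the slope condition `−τ′ + (2M/ϱ)(ϱ′ + τ′) = 0`), then
`K_ν(v, w) = 0` at `y`: `K = g(Dλ(v) ∂_{t*} + λ Γ(∂_{t*})(Φ_v), Φ_w)`, the first term vanishes by
normality and `2 g(Γ(∂_{t*})(Φ_v), Φ_w) = (∂_{Φ_v} g)(∂_{t*}, Φ_w) + (∂_{∂_{t*}} g)(Φ_w, Φ_v) − (∂_{Φ_w} g)(Φ_v, ∂_{t*})`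
vanishes because the components do not depend on `t*` and `(∂_U g)(∂_{t*}, B)` is symmetric in the
radial-frame data of `U`, `B` (time-reflection symmetry of the Schwarzschild metric about a static
slice; Wald 1984, §6.4 problem setting, O'Neill 1983, Ch. 4, Prop. 4.13). [cite: ONeill1983, Ch. 4, Prop. 4.13] -/
theorem secondFundamentalForm_eq_zero_of_static [(Kerr.smoothMetric M 0 r₀).HasLeviCivita]
    (hf : ∀ y : U, (f y : E4) = Φ y) (hν : ∀ y : U, ν y = N y)
    {τ ϱ : ℝ → ℝ} (hΦ : ∀ z, Φ z = τ ‖z‖ • E4.basisVector 0 + (ϱ ‖z‖ / ‖z‖) • E4.spaceEmbed z)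
    {y : U} (hy0 : (y : E3) ≠ 0) {t₁ r₁ : ℝ} (hτ : HasDerivAt τ t₁ ‖(y : E3)‖)
    (hϱ : HasDerivAt ϱ r₁ ‖(y : E3)‖) (hpos : 0 < ϱ ‖(y : E3)‖)
    (hstatic : -t₁ + 2 * M / ϱ ‖(y : E3)‖ * (r₁ + t₁) = 0)
    {lam : E3 → ℝ} (hNlam : N =ᶠ[𝓝 (y : E3)] fun z ↦ lam z • E4.basisVector 0)
    (hlam : DifferentiableAt ℝ lam y) (v w : E3) :
    (Kerr.smoothMetric M 0 r₀).secondFundamentalForm 𝓘(ℝ, E3) f ν y v w = 0 := by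
  have hG : ∀ x : Kerr.region 0 r₀, (Kerr.smoothMetric M 0 r₀).val x = Kerr.bilin M 0 x :=
    fun x ↦ Kerr.smoothMetric_val M 0 r₀ x
  have hs : ‖(y : E3)‖ ≠ 0 := norm_ne_zero_iff.2 hy0
  have hΦfun : Φ = fun z ↦ τ ‖z‖ • E4.basisVector 0 + (ϱ ‖z‖ / ‖z‖) • E4.spaceEmbed z := funext hΦ
  have hd := hasFDerivAt_radialMap hy0 hτ hϱ
  have hΦd : DifferentiableAt ℝ Φ y := by rw [hΦfun]; exact hd.differentiableAt
  have hNd : DifferentiableAt ℝ N y :=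
    (hlam.smul_const (E4.basisVector 0)).congr_of_eventuallyEq hNlam
  have hGd : DifferentiableAt ℝ (Kerr.bilin M 0) (f y) := Kerr.differentiableAt_bilin M 0 (f y)
  have hval : ∀ a b : E4, (Kerr.smoothMetric M 0 r₀).val (f y) a b = Kerr.bilin M 0 (Φ y) a b :=
    fun a b ↦ by rw [hG, hf]; rfl
  rw [OpensChart.secondFundamentalForm_eq_of_repr (g := (Kerr.smoothMetric M 0 r₀).toPseudoRiemannianMetric)
    (G := Kerr.bilin M 0) hG hf hν hΦd hNd hGd v w]
  have hfN : fderiv ℝ N y v = (fderiv ℝ lam y v) • E4.basisVector 0 := by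
    rw [hNlam.fderiv_eq, fderiv_smul_const hlam]; rfl
  have hNy : N y = lam y • E4.basisVector 0 := hNlam.eq_of_nhds
  have hΓ := OpensChart.val_christoffel_const (g := (Kerr.smoothMetric M 0 r₀).toPseudoRiemannianMetric)
    (G := Kerr.bilin M 0) (f y) (E4.basisVector 0) (fderiv ℝ Φ y v) (fderiv ℝ Φ y w)
  rw [hval] at hΓ
  rw [hfN, hNy, OpensChart.christoffel_smul, hval, map_add, add_apply, map_smul, _root_.smul_apply,
    map_smul, _root_.smul_apply, hΓ, OpensChart.koszulForm_apply, hf y, smul_eq_mul, smul_eq_mul]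
  -- the explicit differential and the components of the point
  have hsp : E4.spatial (Φ y) = (ϱ ‖(y : E3)‖ / ‖(y : E3)‖) • (y : E3) := by rw [hΦ]; simp
  have hκ : 0 < ϱ ‖(y : E3)‖ / ‖(y : E3)‖ := div_pos hpos (norm_pos_iff.2 hy0)
  have hsp0 : E4.spatial (Φ y) ≠ 0 := by
    rw [hsp]; exact smul_ne_zero hκ.ne' hy0
  -- normality of `∂_{t*}`
  have h0' : Kerr.bilin M 0 (Φ y)
      ((1 : ℝ) • E4.basisVector 0 + (0 : ℝ) • E4.spaceEmbed (y : E3) + (0 : ℝ) • E4.spaceEmbed w)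
      ((t₁ * ‖(y : E3)‖⁻¹ * ⟪(y : E3), w⟫_ℝ) • E4.basisVector 0 +
        ((r₁ * ‖(y : E3)‖ - ϱ ‖(y : E3)‖) / ‖(y : E3)‖ ^ 3 * ⟪(y : E3), w⟫_ℝ) • E4.spaceEmbed (y : E3) +
          (ϱ ‖(y : E3)‖ / ‖(y : E3)‖) • E4.spaceEmbed w) = 0 := by
    have hr0 : ϱ ‖(y : E3)‖ ≠ 0 := hpos.ne'
    rw [bilin_frame M hκ hy0 hsp]
    calc _ = ⟪(y : E3), w⟫_ℝ / ‖(y : E3)‖ * (-t₁ + 2 * M / ϱ ‖(y : E3)‖ * (r₁ + t₁)) := by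
          field_simp
          ring
      _ = 0 := by rw [hstatic, mul_zero]
  have h0 : Kerr.bilin M 0 (Φ y) (E4.basisVector 0) (fderiv ℝ Φ y w) = 0 := by
    rw [hΦfun, fderiv_radialMap_apply hy0 hτ hϱ w, ← hΦfun]
    simpa using h0'
  rw [h0, mul_zero, zero_add]
  -- the Koszul form of `∂_{t*}` on two tangent vectors vanishes
  rw [hΦfun, fderiv_radialMap_apply hy0 hτ hϱ v, fderiv_radialMap_apply hy0 hτ hϱ w, ← hΦfun,
    Kerr.fderiv_bilin_zero_apply M hsp0, Kerr.fderiv_bilin_zero_apply M hsp0,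
    Kerr.fderiv_bilin_zero_apply M hsp0]
  simp only [Kerr.bilinZeroDeriv_apply, Kerr.nullCovectorZero_apply, Kerr.nullCovectorZeroDeriv_apply,
    frame_apply_zero, spatial_frame, hsp, Kerr.spatial_basisVector_zero,
    Kerr.basisVector_zero_apply_zero, inner_zero_left, inner_zero_right, inner_add_left,
    inner_add_right, inner_smul_left, inner_smul_right, conj_trivial, real_inner_self_eq_norm_sq,
    real_inner_comm v (y : E3), real_inner_comm w (y : E3), real_inner_comm w v]
  ring

end Static

/-! ### The Kerr–Schild graph `t* = 4M log(1 − r/2M)`: the second fundamental form is `kRep` -/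

section KSGraph

variable {M r₀ : ℝ} [Kerr.Facts] {U : TopologicalSpace.Opens E3} {f : U → Kerr.region 0 r₀} {Φ N : E3 → E4}
  {ν : NormalField 𝓘(ℝ, E4) f} {τ ϱ τ' ϱ' : ℝ → ℝ}

/-- **The second fundamental form of the graph `t* = G(r)`, `G′ = −4M/(2M − r)`, inside the horizon,
with respect to its future unit normal, is Cook's Kerr–Schild slice tensor `kRep`.** In the ingoing
chart of the other exterior this graph is the Kerr–Schild slice `{t* = const}` (the transition
`t* ↦ −t* + 4M log(1 − r/2M)` is an isometry of the Schwarzschild Kerr–Schild form preserving the time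
orientation on `0 < r < 2M`), so its data are the slice data; here this is verified directly from the
coordinate formula for `K` (`secondFundamentalForm_eq_half_of_repr`) and the closed-form first derivatives
of the components (`Kerr.fderiv_bilin_zero_apply`). Cook 2000, §3.2.2, (57); O'Neill 1983, Ch. 13
(Kruskal plane). [cite: Cook2000, §3.2.2 (57)] -/
theorem secondFundamentalForm_eq_kRep [(Kerr.smoothMetric M 0 r₀).HasLeviCivita] (hM : 0 < M)
    (hf : ∀ y : U, (f y : E4) = Φ y) (hν : ∀ y : U, ν y = N y)
    (hΦ : ∀ z, Φ z = τ ‖z‖ • E4.basisVector 0 + (ϱ ‖z‖ / ‖z‖) • E4.spaceEmbed z)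
    (hN : ∀ z, N z = (√(-τ' ‖z‖ ^ 2 + ϱ' ‖z‖ ^ 2 + 2 * M / ϱ ‖z‖ * (τ' ‖z‖ + ϱ' ‖z‖) ^ 2))⁻¹ •
      ((-ϱ' ‖z‖ - 2 * M / ϱ ‖z‖ * (ϱ' ‖z‖ + τ' ‖z‖)) • E4.basisVector 0 +
        ((-τ' ‖z‖ + 2 * M / ϱ ‖z‖ * (ϱ' ‖z‖ + τ' ‖z‖)) / ‖z‖) • E4.spaceEmbed z))
    {y : U} (hy0 : (y : E3) ≠ 0) (hy2 : ‖(y : E3)‖ < 2 * M)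
    (hτd : ∀ᶠ t in 𝓝 ‖(y : E3)‖, HasDerivAt τ (τ' t) t) (hϱd : ∀ᶠ t in 𝓝 ‖(y : E3)‖, HasDerivAt ϱ (ϱ' t) t)
    (hϱid : ∀ᶠ t in 𝓝 ‖(y : E3)‖, ϱ t = t) (hϱ'1 : ∀ᶠ t in 𝓝 ‖(y : E3)‖, ϱ' t = 1)
    (hτ'G : ∀ᶠ t in 𝓝 ‖(y : E3)‖, τ' t = -(4 * M) / (2 * M - t))
    (hτ'' : HasDerivAt τ' (-(4 * M) / (2 * M - ‖(y : E3)‖) ^ 2) ‖(y : E3)‖)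
    (hNd : DifferentiableAt ℝ N y) (v w : E3) :
    (Kerr.smoothMetric M 0 r₀).secondFundamentalForm 𝓘(ℝ, E3) f ν y v w = Kerr.kRep M y v w := by
  -- notation for the point
  set s := ‖(y : E3)‖ with hs_def
  have hs : s ≠ 0 := norm_ne_zero_iff.2 hy0
  have hspos : 0 < s := norm_pos_iff.2 hy0
  have h2s : 2 * M - s ≠ 0 := by linarith
  have h2s' : M * 2 - s ≠ 0 := by rwa [mul_comm] at h2s
  have hG : ∀ x : Kerr.region 0 r₀, (Kerr.smoothMetric M 0 r₀).val x = Kerr.bilin M 0 x :=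
    fun x ↦ Kerr.smoothMetric_val M 0 r₀ x
  -- the local data at the point
  have hτy : HasDerivAt τ (τ' s) s := hτd.self_of_nhds
  have hϱy : HasDerivAt ϱ (ϱ' s) s := hϱd.self_of_nhds
  have hϱs : ϱ s = s := hϱid.self_of_nhds
  have hϱ's : ϱ' s = 1 := hϱ'1.self_of_nhds
  have hτ's : τ' s = -(4 * M) / (2 * M - s) := hτ'G.self_of_nhds
  have hΦfun : Φ = fun z ↦ τ ‖z‖ • E4.basisVector 0 + (ϱ ‖z‖ / ‖z‖) • E4.spaceEmbed z := funext hΦ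
  have hΦd : DifferentiableAt ℝ Φ y := by
    rw [hΦfun]; exact (hasFDerivAt_radialMap hy0 hτy hϱy).differentiableAt
  -- the differential near `y` on the constant field `w`
  have hnorm_ev : ∀ᶠ z : E3 in 𝓝 (y : E3), z ≠ 0 := isOpen_ne.mem_nhds hy0
  have hcont : ContinuousAt (fun z : E3 ↦ ‖z‖) (y : E3) := continuous_norm.continuousAt
  have hτd' := hcont.eventually hτd
  have hϱd' := hcont.eventually hϱd
  have hϱid' := hcont.eventually hϱid
  have hϱ'1' := hcont.eventually hϱ'1
  have hDΦ : (fun z : E3 ↦ fderiv ℝ Φ z w) =ᶠ[𝓝 (y : E3)]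
      fun z ↦ (τ' ‖z‖ / ‖z‖ * ⟪z, w⟫_ℝ) • E4.basisVector 0 + E4.spaceEmbed w := by
    filter_upwards [hnorm_ev, hτd', hϱd', hϱid', hϱ'1'] with z hz hτz hϱz hϱiz hϱ'z
    have hz' : ‖z‖ ≠ 0 := norm_ne_zero_iff.2 hz
    rw [hΦfun, fderiv_radialMap_apply hz hτz hϱz w, hϱiz, hϱ'z, one_mul, sub_self, zero_div, zero_mul,
      zero_smul, add_zero, div_self hz', one_smul, div_eq_mul_inv]
  -- its derivative at `y`
  have hF : HasFDerivAt (fun z : E3 ↦ τ' ‖z‖ / ‖z‖ * ⟪z, w⟫_ℝ)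
      ((τ' s / s) • E3.covec w +
        ⟪(y : E3), w⟫_ℝ • (((-(4 * M) / (2 * M - s) ^ 2 * s - τ' s) / s ^ 3) • E3.covec (y : E3))) (y : E3) :=
    (hasFDerivAt_comp_norm_div (ϱ := τ') hy0 hτ'').mul (Kerr.hasFDerivAt_inner_left (y : E3) w)
  have hΦ₂ : HasFDerivAt (fun z : E3 ↦ fderiv ℝ Φ z w)
      (((τ' s / s) • E3.covec w +
        ⟪(y : E3), w⟫_ℝ • (((-(4 * M) / (2 * M - s) ^ 2 * s - τ' s) / s ^ 3) • E3.covec (y : E3))).smulRight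
        (E4.basisVector 0)) (y : E3) := by
    refine HasFDerivAt.congr_of_eventuallyEq ?_ hDΦ
    have h := (hF.smul_const (E4.basisVector 0)).add_const (E4.spaceEmbed w)
    exact h
  -- the normality relation near `y`
  have hϱpos' : ∀ᶠ z : E3 in 𝓝 (y : E3), 0 < ϱ ‖z‖ := by
    filter_upwards [hnorm_ev, hϱid'] with z hz hϱz
    rw [hϱz]; exact norm_pos_iff.2 hz
  have hnormal : ∀ᶠ z : E3 in 𝓝 (y : E3), Kerr.bilin M 0 (Φ z) (N z) (fderiv ℝ Φ z w) = 0 := by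
    filter_upwards [hnorm_ev, hτd', hϱd', hϱpos'] with z hz hτz hϱz hϱp
    have hxz : E4.spatial (Φ z) = (ϱ ‖z‖ / ‖z‖) • z := by rw [hΦ]; simp
    have h := bilin_rawNormal_tangent M (t₁ := τ' ‖z‖) (r₁ := ϱ' ‖z‖) hϱp hz hxz w w
    rw [zero_smul, add_zero] at h
    rw [hΦfun, fderiv_radialMap_apply hz hτz hϱz w, ← hΦfun, hN, map_smul, _root_.smul_apply, smul_eq_mul, h,
      mul_zero]
  -- the normal at `y`
  have hA : -τ' s ^ 2 + ϱ' s ^ 2 + 2 * M / ϱ s * (τ' s + ϱ' s) ^ 2 = 1 + 2 * M / s := by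
    rw [hϱ's, hϱs, hτ's]
    field_simp
    ring
  have hApos : 0 < 1 + 2 * M / s := by positivity
  set S := √(1 + 2 * M / s) with hS_def
  have hS0 : S ≠ 0 := (Real.sqrt_pos.2 hApos).ne'
  have hS2 : S ^ 2 = 1 + 2 * M / s := Real.sq_sqrt hApos.le
  have hNy : N y = (S⁻¹ * (-1 - 2 * M / s * (1 + τ' s))) • E4.basisVector 0 +
      (S⁻¹ * ((-τ' s + 2 * M / s * (1 + τ' s)) / s)) • E4.spaceEmbed (y : E3) := by
    rw [hN, ← hs_def, hA, ← hS_def, hϱ's, hϱs, smul_add, smul_smul, smul_smul]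
  have hGd : DifferentiableAt ℝ (Kerr.bilin M 0) (Φ y) := by
    rw [← hf y]; exact Kerr.differentiableAt_bilin M 0 (f y)
  -- the coordinate formula
  rw [secondFundamentalForm_eq_half_of_repr (g := (Kerr.smoothMetric M 0 r₀).toPseudoRiemannianMetric)
    (G := Kerr.bilin M 0) hG hf hν hΦd hNd hGd v w hΦ₂ hnormal]
  -- the differential at `y`
  have hDΦy : ∀ u : E3, fderiv ℝ Φ y u = (τ' s / s * ⟪(y : E3), u⟫_ℝ) • E4.basisVector 0 + E4.spaceEmbed u := by
    intro u
    rw [hΦfun, fderiv_radialMap_apply hy0 hτy hϱy u, ← hs_def, hϱs, hϱ's, one_mul, sub_self, zero_div,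
      zero_mul, zero_smul, add_zero, div_self hs, one_smul, div_eq_mul_inv]
  have hspy : E4.spatial (Φ y) = (y : E3) := by
    rw [hΦ, ← hs_def, hϱs, div_self hs]; simp
  have hsp0 : E4.spatial (Φ y) ≠ 0 := by rw [hspy]; exact hy0
  have hspn : E4.spatialNorm (Φ y) = s := by rw [E4.spatialNorm, hspy]
  rw [hDΦy v, hDΦy w, hNy, Kerr.fderiv_bilin_zero_apply M hsp0, Kerr.fderiv_bilin_zero_apply M hsp0,
    Kerr.fderiv_bilin_zero_apply M hsp0, Kerr.bilin_zero_spin_apply M (by rw [hspn]; exact hs), Kerr.kRep]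
  simp only [Kerr.bilinZeroDeriv_apply, Kerr.nullCovectorZero_apply, Kerr.nullCovectorZeroDeriv_apply,
    hspy, hspn, ContinuousLinearMap.smulRight_apply, add_apply, FunLike.coe_smul, Pi.smul_apply,
    E3.covec_apply, smul_eq_mul, PiLp.add_apply, PiLp.smul_apply, map_add, map_smul, E4.spaceEmbed_apply,
    E4.ofTimeSpace_apply_zero, E4.spatial_ofTimeSpace, Kerr.spatial_basisVector_zero,
    Kerr.basisVector_zero_apply_zero, mul_zero, mul_one, add_zero, zero_add, smul_zero,
    inner_zero_left, inner_zero_right, inner_smul_right,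
    real_inner_self_eq_norm_sq, real_inner_comm v (y : E3), real_inner_comm w (y : E3),
    real_inner_comm w v, ← hs_def]
  rw [hτ's, ← hS_def]
  field_simp
  ring

end KSGraph

/-! ### The induced metric at the two rims -/

section Rims

variable (M : ℝ) {x : E4} {y : E3} {t₁ r r₁ : ℝ}

/-- **Outer rim: the induced metric of the Kerr–Schild graph is `hRep`.** With `ϱ = s`, `ϱ′ = 1`,
`τ′ = −4M/(2M − s)` the radial coefficient is `A = 1 + 2M/s` and the tangential one `B = 1`, so
`g(DΦ v, DΦ w) = ⟪v, w⟫ + (2M/s³)⟪y, v⟫⟪y, w⟫ = hRep M y v w` (Cook 2000, (55)). [cite: Cook2000, §3.2.2 (55)] -/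
theorem bilin_tangent_tangent_eq_hRep (hy : y ≠ 0) (hy2 : 2 * M - ‖y‖ ≠ 0)
    (hx : E4.spatial x = (‖y‖ / ‖y‖) • y) (ht₁ : t₁ = -(4 * M) / (2 * M - ‖y‖)) (v w : E3) :
    Kerr.bilin M 0 x
        ((t₁ * ‖y‖⁻¹ * ⟪y, v⟫_ℝ) • E4.basisVector 0 +
          ((1 * ‖y‖ - ‖y‖) / ‖y‖ ^ 3 * ⟪y, v⟫_ℝ) • E4.spaceEmbed y + (‖y‖ / ‖y‖) • E4.spaceEmbed v)
        ((t₁ * ‖y‖⁻¹ * ⟪y, w⟫_ℝ) • E4.basisVector 0 +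
          ((1 * ‖y‖ - ‖y‖) / ‖y‖ ^ 3 * ⟪y, w⟫_ℝ) • E4.spaceEmbed y + (‖y‖ / ‖y‖) • E4.spaceEmbed w) =
      Kerr.hRep M y v w := by
  have hs : ‖y‖ ≠ 0 := norm_ne_zero_iff.2 hy
  have hy2' : M * 2 - ‖y‖ ≠ 0 := by rwa [mul_comm] at hy2
  rw [bilin_tangent_tangent M (r₁ := 1) (norm_pos_iff.2 hy) hy hx v w, Kerr.hRep_apply, ht₁]
  field_simp
  ring

/-- **Inner rim: the induced metric of the Boyer–Lindquist slice read through the isotropic radial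
map is conformally flat**: with `ϱ = s(1 + M/2s)² = (2s + M)²/(4s)` (the sheet-two isotropic→areal map),
`ϱ′ = (2s − M)(2s + M)/(4s²)` and the Boyer–Lindquist slope `τ′ = (2M/(ϱ − 2M)) ϱ′ = 2M(2s + M)/(s(2s − M))`,
both coefficients equal `(1 + M/2s)⁴`: `g(DΦ v, DΦ w) = (1 + M/2s)⁴ ⟪v, w⟫` (time-symmetric Schwarzschild
data in isotropic coordinates, `h = (1 + M/2ρ)⁴ δ`). [cite: Wald1984, §6.4] -/
theorem bilin_tangent_tangent_eq_iso (hy : y ≠ 0) (hsM : 2 * ‖y‖ - M ≠ 0) (hr0 : 0 < r)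
    (hx : E4.spatial x = (r / ‖y‖) • y) (hr : r = (2 * ‖y‖ + M) ^ 2 / (4 * ‖y‖))
    (hr₁ : r₁ = (2 * ‖y‖ - M) * (2 * ‖y‖ + M) / (4 * ‖y‖ ^ 2))
    (ht₁ : t₁ = 2 * M * (2 * ‖y‖ + M) / (‖y‖ * (2 * ‖y‖ - M))) (v w : E3) :
    Kerr.bilin M 0 x
        ((t₁ * ‖y‖⁻¹ * ⟪y, v⟫_ℝ) • E4.basisVector 0 +
          ((r₁ * ‖y‖ - r) / ‖y‖ ^ 3 * ⟪y, v⟫_ℝ) • E4.spaceEmbed y + (r / ‖y‖) • E4.spaceEmbed v)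
        ((t₁ * ‖y‖⁻¹ * ⟪y, w⟫_ℝ) • E4.basisVector 0 +
          ((r₁ * ‖y‖ - r) / ‖y‖ ^ 3 * ⟪y, w⟫_ℝ) • E4.spaceEmbed y + (r / ‖y‖) • E4.spaceEmbed w) =
      (1 + M / (2 * ‖y‖)) ^ 4 * ⟪v, w⟫_ℝ := by
  have hs : ‖y‖ ≠ 0 := norm_ne_zero_iff.2 hy
  have hsM' : ‖y‖ * 2 - M ≠ 0 := by rwa [mul_comm] at hsM
  have hpM : 2 * ‖y‖ + M ≠ 0 := by
    intro h
    rw [h] at hr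
    simp at hr
    exact hr0.ne' hr
  have hpM' : ‖y‖ * 2 + M ≠ 0 := by rwa [mul_comm] at hpM
  rw [bilin_tangent_tangent M hr0 hy hx v w, hr, hr₁, ht₁]
  field_simp
  ring

end Rims

end Bridge

/-- **Registered export of this file** (sub-goal `bridge_outerRimMetric` of stub `stub_bridgeAnnulus`): the induced metric of the Kerr–Schild graph `t* = 4M log(1 − r/2M)` is `hRep`, `Bridge.bilin_tangent_tangent_eq_hRep`. [cite: Cook2000, §3.2.2 (55)] -/
theorem bridge_outerRimMetric :
    ∀ (M : ℝ) (x : E4) (y : E3) (t₁ : ℝ), y ≠ 0 → 2 * M - ‖y‖ ≠ 0 → E4.spatial x = (‖y‖ / ‖y‖) • y → t₁ = -(4 * M) / (2 * M - ‖y‖) → ∀ (v w : E3), Kerr.bilin M 0 x ((t₁ * ‖y‖⁻¹ * ⟪y, v⟫_ℝ) • E4.basisVector 0 + ((1 * ‖y‖ - ‖y‖) / ‖y‖ ^ 3 * ⟪y, v⟫_ℝ) • E4.spaceEmbed y + (‖y‖ / ‖y‖) • E4.spaceEmbed v) ((t₁ * ‖y‖⁻¹ * ⟪y, w⟫_ℝ)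 • E4.basisVector 0 + ((1 * ‖y‖ - ‖y‖) / ‖y‖ ^ 3 * ⟪y, w⟫_ℝ) • E4.spaceEmbed y + (‖y‖ / ‖y‖) • E4.spaceEmbed w) = Kerr.hRep M y v w :=
  fun M _ _ _ hy hy2 hx ht₁ v w ↦ Bridge.bilin_tangent_tangent_eq_hRep M hy hy2 hx ht₁ v w

end Summit.FinalStateConjecture.FinalStateConjecture.Theorems.SwallowTheDatum

end
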